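import Literature.Geometry.Lorentzian.CausalCurveLift
import HarnessLib

/-!
# Pulling back TIMELIKE curves along an injective local isometry

(family `gr`; companion of `CausalCurveLift.lean`; written for the last-exit argument of crux
`EIHFluxBalance.ModulatedKerrHandoff`, stmt-FinalStateConjecture-10167, stub `stub_exteriorLastExit`.)

The timelike twin of `LorentzianMetric.IsFutureCausalCurveOn.invFun_comp`
(`Literature/Geometry/Lorentzian/CausalCurveLift.lean`): for `Φ : N → P` an injective `C^∞` local
diffeomorphism between time-oriented Lorentzian manifolds which is an isometric immersion preserving the time
orientations, a future TIMELIKE curve `γ` of `P` on `s` with `γ(s) ⊆ Φ(N)` pulls back to the future timelike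
curve `Function.invFun Φ ∘ γ` of `N` on `s` (same proof: locally `Φ⁻¹ ∘ γ = e⁻¹ ∘ γ` for a smooth local inverse,
so `dΦ(δ') = γ'`, and `dΦ` preserves scalar products).  Used by the last-exit argument of the stub to read a
timelike curve of the maximal development inside the image of the Kerr collar as a timelike curve of the chart.

Everything is proved; no definitions, no named facts.

## References

* B. O'Neill, *Semi-Riemannian geometry*, Academic Press 1983, Ch. 3, pp. 90–91; Ch. 14, p. 402.
* J. Sbierski, Ann. Henri Poincaré 17 (2016) 301–329, §3.3.
-/

noncomputable section

open Bundle Set Function Filter Manifold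
open scoped Manifold ContDiff Topology

namespace Literature.Geometry.Lorentzian

section Lift

variable {EN : Type*} [NormedAddCommGroup EN] [NormedSpace ℝ EN] {HN : Type*} [TopologicalSpace HN]
  {IN : ModelWithCorners ℝ EN HN} {N : Type*} [TopologicalSpace N] [ChartedSpace HN N]
  [IsManifold IN ∞ N]
  {EP : Type*} [NormedAddCommGroup EP] [NormedSpace ℝ EP] {HP : Type*} [TopologicalSpace HP]
  {IP : ModelWithCorners ℝ EP HP} {P : Type*} [TopologicalSpace P] [ChartedSpace HP P]
  [IsManifold IP ∞ P]
  {gN : LorentzianMetric IN ∞ N} {τN : TimeOrientation gN}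
  {gP : LorentzianMetric IP ∞ P} {τP : TimeOrientation gP} {Φ : N → P}

omit [IsManifold IN ∞ N] [IsManifold IP ∞ P] in
/-- **The pulled-back curve has the right velocity**: for `Φ : N → P` an injective `C^∞` local diffeomorphism and
`γ` differentiable at `t` with `γ t ∈ Φ(N)`, the curve `δ = Function.invFun Φ ∘ γ` is differentiable at `t` and
`dΦ_{δ t}(δ' t) = γ' t` (near `t`, `δ = e⁻¹ ∘ γ` and `γ = Φ ∘ δ` for a smooth local inverse `e⁻¹` of `Φ`).
O'Neill 1983, Ch. 3, pp. 90–91. [cite: ONeillSemiRiemannian1983, Ch. 3, pp. 90–91] -/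
theorem mdifferentiableAt_invFun_comp_and_mfderiv [Nonempty N] (hΦc : ContMDiff IN IP ∞ Φ)
    (hinj : Injective Φ) (hloc : IsLocalDiffeomorph IN IP ∞ Φ) {γ : ℝ → P} {t : ℝ}
    (hγd : MDifferentiableAt 𝓘(ℝ, ℝ) IP γ t) (ht : γ t ∈ range Φ) :
    MDifferentiableAt 𝓘(ℝ, ℝ) IN (Function.invFun Φ ∘ γ) t ∧
      Φ ((Function.invFun Φ ∘ γ) t) = γ t ∧
      mfderiv IN IP Φ ((Function.invFun Φ ∘ γ) t) (velocity IN (Function.invFun Φ ∘ γ) t) =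
        velocity IP γ t := by
  set δ : ℝ → N := Function.invFun Φ ∘ γ with hδ_def
  have hΦδ : Φ (δ t) = γ t := Function.invFun_eq ht
  obtain ⟨e, hsrc, heq⟩ := hloc (δ t)
  have htgt : γ t ∈ e.target := by
    rw [← hΦδ, heq hsrc]
    exact e.map_source hsrc
  have hnhds : ∀ᶠ t' in 𝓝 t, γ t' ∈ e.target :=
    hγd.continuousAt.preimage_mem_nhds (e.open_target.mem_nhds htgt)
  have hright : ∀ t', γ t' ∈ e.target → Φ (e.symm (γ t')) = γ t' := fun t' ht' ↦ by
    have hw : e.symm (γ t') ∈ e.source := e.map_target ht'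
    rw [heq hw]
    exact e.right_inv ht'
  have hev : δ =ᶠ[𝓝 t] (e.symm ∘ γ) := by
    filter_upwards [hnhds] with t' ht'
    show Function.invFun Φ (γ t') = e.symm (γ t')
    conv_lhs => rw [← hright t' ht']
    exact Function.leftInverse_invFun hinj _
  have hes : ContMDiffAt IP IN ∞ e.symm (γ t) :=
    e.contMDiffOn_invFun.contMDiffAt (e.open_target.mem_nhds htgt)
  have hδd : MDifferentiableAt 𝓘(ℝ, ℝ) IN δ t :=
    hev.mdifferentiableAt_iff.2 ((hes.mdifferentiableAt (by simp)).comp t hγd)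
  have hev2 : γ =ᶠ[𝓝 t] (Φ ∘ δ) := by
    filter_upwards [hev, hnhds] with t' h1 h2
    show γ t' = Φ (δ t')
    rw [h1]
    exact (hright t' h2).symm
  have hΦd : MDifferentiable IN IP Φ := hΦc.mdifferentiable (by simp)
  have hv : mfderiv IN IP Φ (δ t) (velocity IN δ t) = velocity IP γ t := by
    have h1 : mfderiv 𝓘(ℝ, ℝ) IP γ t =
        (mfderiv IN IP Φ (δ t)).comp (mfderiv 𝓘(ℝ, ℝ) IN δ t) := by
      rw [hev2.mfderiv_eq, mfderiv_comp t (hΦd _) hδd]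
    change mfderiv IN IP Φ (δ t) (mfderiv 𝓘(ℝ, ℝ) IN δ t (1 : ℝ)) =
      mfderiv 𝓘(ℝ, ℝ) IP γ t (1 : ℝ)
    rw [h1]
    rfl
  exact ⟨hδd, hΦδ, hv⟩

/-- **Future timelike curves inside the range of an injective local isometry pull back to future timelike
curves.**  Let `Φ : N → P` be an injective `C^∞` local diffeomorphism between time-oriented Lorentzian manifolds
which is an isometric immersion preserving the time orientations, and `γ` a future timelike curve of `P` on `s`
with `γ(s) ⊆ Φ(N)`.  Then `Function.invFun Φ ∘ γ` is a future timelike curve of `N` on `s`: it is future causal by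
`LorentzianMetric.IsFutureCausalCurveOn.invFun_comp`, and timelike because `dΦ(δ') = γ'` and `dΦ` preserves scalar products.
O'Neill 1983, Ch. 3, pp. 90–91 and Ch. 14, p. 402; Sbierski 2016, §3.3.
[cite: ONeillSemiRiemannian1983, Ch. 14, p. 402] -/
theorem LorentzianMetric.IsFutureTimelikeCurveOn.invFun_comp [Nonempty N]
    (hΦ : gN.IsIsometricImmersion gP.toPseudoRiemannianMetric Φ)
    (hτ : τN.PreservesTimeOrientation Φ τP) (hinj : Injective Φ)
    (hloc : IsLocalDiffeomorph IN IP ∞ Φ)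
    {γ : ℝ → P} {s : Set ℝ} (hγ : gP.IsFutureTimelikeCurveOn τP γ s)
    (hs : ∀ t ∈ s, γ t ∈ range Φ) :
    gN.IsFutureTimelikeCurveOn τN (Function.invFun Φ ∘ γ) s := by
  have hc := hγ.isFutureCausalCurveOn.invFun_comp hΦ hτ hinj hloc hs
  intro t ht
  obtain ⟨hδd, hfd⟩ := hc t ht
  refine ⟨hδd, ?_, hfd⟩
  obtain ⟨-, hΦδ, hv⟩ :=
    mdifferentiableAt_invFun_comp_and_mfderiv hΦ.1 hinj hloc (hγ t ht).1 (hs t ht)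
  have key : ∀ u w : TangentSpace IN ((Function.invFun Φ ∘ γ) t),
      gP.val (Φ ((Function.invFun Φ ∘ γ) t)) (mfderiv IN IP Φ ((Function.invFun Φ ∘ γ) t) u)
        (mfderiv IN IP Φ ((Function.invFun Φ ∘ γ) t) w) = gN.val ((Function.invFun Φ ∘ γ) t) u w :=
    fun u w ↦ by
    have h := congrArg (fun b ↦ b u w) (hΦ.2 ((Function.invFun Φ ∘ γ) t))
    simpa only [pullbackBilin_apply] using h
  have hgen : ∀ p, p = γ t → gP.val p (velocity IP γ t) (velocity IP γ t) < 0 := by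
    rintro p rfl
    exact (hγ t ht).2.1
  have htl := hgen _ hΦδ
  rw [← hv, key] at htl
  exact htl

end Lift

end Literature.Geometry.Lorentzian

end
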